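import Summits.BirchSwinnertonDyer.BirchSwinnertonDyer.Theorems.CMKolyvaginAtInertTwoInertOrderSplittingConj
import Summits.BirchSwinnertonDyer.BirchSwinnertonDyer.Theorems.CMKolyvaginAtInertTwoFrobeniusBridgeAtTwo
import HarnessLib

/-!
# Route `CMKolyvaginAtInertTwo`, crux `CMKolyvaginExactAtInertTwo` (stmt-BirchSwinnertonDyer-24277):
# the inert-order splitting ON `H₂` — for `E/ℚ` with CM, `2` inert in the CM field `F`, `ρ̄_{E,2}`
# onto and `j ≠ −12288000` (maximal orders), every number field `K ∋ √d_F` and every involution of `K`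
# lifted by complex conjugation: `H¹(K, E_K[2^M])` splits exactly — `#S = (#S^{c})²` for finite stable `S`

Seat `bsd-line-cmk2-p1` g10 (cell `bsd-print-cf2`); helper (`--supports stmt-BirchSwinnertonDyer-24277`).
THEOREMS ONLY: no definition, no named fact, no `sorry`; no item is closed; BSD is not proved by this.
Memo `Cruxes/CMExactDescentAtTwo/MEMO-inert-order-splitting.md` §§3–4; KERNEL-STATUS v9 §9.

* `isSquare_Δ_baseChange_of_isSquare_cmFieldDiscr` — on `H₂`, `Δ_E = d_F·s²` (g3's
  `exists_Δ_eq_cmFieldDiscr_mul_sq_of_cmInert_two`), so `√d_F ∈ K ⟹ Δ_{E_K} ∈ K^{×2}`.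
* `exists_cmGenerator_splitting_of_habitat` — the habitat package of `…InertOrderSplittingConj` with
  the CM data discharged from `HasCM ∧ CMInert W 2 ∧ ρ̄₂ onto ∧ j ≠ −12288000` (ty2's six maximal inert
  orders `d ∈ {−3, −11, −19, −43, −67, −163}`, `4c = d(d−1)` odd; `Δ < 0` by g2's `Δ_neg_of_cmInert_two`).
  Inputs left: `√d_F ∈ K`, an involution `σ` of `K` lifted by a transported complex conjugation, and
  `z ∈ Γ_K` without non-zero fixed point on `E_K[2]` (for `[K : K_H] = 2`:
  `exists_fixedPointFree_two_of_finrank_eq_two`). The order `ℤ[3ζ₃]` (`j = −12288000`) needs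
  `η = φ̂ ω φ` through ty2's kernel-`x` `3`-isogeny and is not covered here.

References: Lang, *Elliptic Functions*, Ch. 10 §4 [Lang1987]; Silverman, *Advanced Topics*, App. A §3
[SilvermanATAEC1994]; Silverman *AEC* III.§1 [SilvermanAEC2009].
-/

-- single-conjunct summit: `Summit.BirchSwinnertonDyer.BirchSwinnertonDyer.…` repeats the name by design
set_option linter.dupNamespace false
set_option autoImplicit false

noncomputable section

open scoped Classical

namespace Summit.BirchSwinnertonDyer.BirchSwinnertonDyer.Theorems.InertOrderSplittingHabitat

open WeierstrassCurve Field
open Literature.NumberTheory.EllipticCurves Literature.NumberTheory.EllipticCurves.Rank1Residual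
open Literature.NumberTheory.GaloisRepresentations
open Summit.BirchSwinnertonDyer.BirchSwinnertonDyer.Theorems.KolyvaginEigenTwo
open Summit.BirchSwinnertonDyer.BirchSwinnertonDyer.Theorems.KolyvaginFrobeniusTwo
open Summit.BirchSwinnertonDyer.Rank1Residual Summit.BirchSwinnertonDyer.Rank1Residual.P2

variable (W : WeierstrassCurve ℚ) [W.IsElliptic] (K : Type) [Field K] [NumberField K]

/-- **`√d_F ∈ K ⟹ Δ_{E_K} ∈ K^{×2}` on `H₂`** (`Δ_E = d_F·s²`, `d_F = cmFieldDiscrOfJ j(E)`).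
[cite: SilvermanATAEC1994, App. A §3] -/
theorem isSquare_Δ_baseChange_of_isSquare_cmFieldDiscr (hCM : W.HasCM) (hin : CMInert W 2)
    (hsurj : W.HasSurjectiveModNGaloisRep 2)
    (hF : IsSquare (algebraMap ℚ K (cmFieldDiscrOfJ W.j))) : IsSquare (W.baseChange K).Δ := by
  obtain ⟨-, s, hs⟩ := exists_Δ_eq_cmFieldDiscr_mul_sq_of_cmInert_two W hCM hin hsurj
  have hΔ : (W.baseChange K).Δ = algebraMap ℚ K W.Δ := by
    rw [baseChange, map_Δ]
  rw [hΔ, hs, map_mul, map_pow]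
  exact hF.mul (IsSquare.sq _)

variable {K}
variable {σ : K ≃ₐ[ℚ] K} {c₀ : absoluteGaloisGroup ℚ}

/-- **THE SPLITTING PACKAGE ON `H₂` (maximal orders).** For `E/ℚ` with CM, `2` inert in the CM field,
`ρ̄_{E,2}` onto and `j(E) ≠ −12288000`; `K` a number field containing `√d_F`; `σ ∈ Aut(K/ℚ)` an
involution lifted by the transport of a complex conjugation `c₀`; `z ∈ Γ_K` without non-zero fixed point
on `E_K[2]`: there are odd `m, c` and a `Γ_K`-equivariant `η` on `E_K(K̄)` with `η² + mη = c`, with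
restrictions `ηn` to every `E_K[2^M]`, such that every finite `σ_*`-, `η_*`-stable
`S ≤ H¹(K, E_K[2^M])` has `#S = (#S^{σ})²`. [cite: Lang1987, Ch. 10 §4, Remark]
[cite: SilvermanATAEC1994, App. A §3] -/
theorem exists_cmGenerator_splitting_of_habitat (hCM : W.HasCM) (hin : CMInert W 2)
    (hsurj : W.HasSurjectiveModNGaloisRep 2) (hj12 : W.j ≠ -12288000)
    (hF : IsSquare (algebraMap ℚ K (cmFieldDiscrOfJ W.j)))
    (hc₀ : IsComplexConjugation (Rat.castHom ℝ) c₀) (hσ : σ * σ = 1)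
    (hτ : IsLiftOfAut σ (absGaloisTransport (K := ℚ) (L := K) c₀).toRingEquiv)
    {z : absoluteGaloisGroup K}
    (hz : ∀ P : geomPoints (W.baseChange K), (2 : ℤ) • P = 0 → z • P = P → P = 0) :
    ∃ (m c : ℤ) (η : AddMonoid.End (geomPoints (W.baseChange K))), Odd m ∧ Odd c ∧
      (∀ P : geomPoints (W.baseChange K), η (η P) + m • η P = c • P) ∧
      (∀ (γ : absoluteGaloisGroup K) (P : geomPoints (W.baseChange K)), γ • η P = η (γ • P)) ∧
      ∀ M : ℕ, ∃ ηn : geomTorsion (W.baseChange K) ((2 : ℤ) ^ M) →+ geomTorsion (W.baseChange K) ((2 : ℤ) ^ M),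
        ∃ hηnG : ∀ (x : absoluteGaloisGroup K) (P : geomTorsion (W.baseChange K) ((2 : ℤ) ^ M)),
            ηn (ContinuousMonoidHom.id (absoluteGaloisGroup K) x • P) = x • ηn P,
          (∀ P : geomTorsion (W.baseChange K) ((2 : ℤ) ^ M), (ηn P : geomPoints (W.baseChange K)) = η P) ∧
          ∀ S : AddSubgroup (galH1Torsion (W.baseChange K) ((2 : ℤ) ^ M)),
            (∀ x ∈ S, conjAct W σ _ x ∈ S) →
            (∀ x ∈ S, resH1Hom (ContinuousMonoidHom.id _) ηn hηnG x ∈ S) →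
              Nat.card S =
                Nat.card {x : S // conjAct W σ _ (x : galH1Torsion (W.baseChange K) ((2 : ℤ) ^ M)) = x} ^ 2 := by
  have hΔ : W.Δ < 0 := Δ_neg_of_cmInert_two W hCM hin hsurj
  have hΔK : IsSquare (W.baseChange K).Δ := isSquare_Δ_baseChange_of_isSquare_cmFieldDiscr W K hCM hin hsurj hF
  have h54 : W.j ≠ 54000 := fun hj ↦ InertAtlas.not_hasSurjectiveModNGaloisRep_two_of_j_eq_54000 W hj hsurj
  -- the package for given `(d, c)`
  have main : ∀ {d c : ℤ}, W.j ∈ maximalCMJInvariants → cmDiscr W.j = d → d * (d - 1) = 4 * c → Odd d →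
      Odd c → ∃ (m c : ℤ) (η : AddMonoid.End (geomPoints (W.baseChange K))), Odd m ∧ Odd c ∧
      (∀ P : geomPoints (W.baseChange K), η (η P) + m • η P = c • P) ∧
      (∀ (γ : absoluteGaloisGroup K) (P : geomPoints (W.baseChange K)), γ • η P = η (γ • P)) ∧
      ∀ M : ℕ, ∃ ηn : geomTorsion (W.baseChange K) ((2 : ℤ) ^ M) →+ geomTorsion (W.baseChange K) ((2 : ℤ) ^ M),
        ∃ hηnG : ∀ (x : absoluteGaloisGroup K) (P : geomTorsion (W.baseChange K) ((2 : ℤ) ^ M)),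
            ηn (ContinuousMonoidHom.id (absoluteGaloisGroup K) x • P) = x • ηn P,
          (∀ P : geomTorsion (W.baseChange K) ((2 : ℤ) ^ M), (ηn P : geomPoints (W.baseChange K)) = η P) ∧
          ∀ S : AddSubgroup (galH1Torsion (W.baseChange K) ((2 : ℤ) ^ M)),
            (∀ x ∈ S, conjAct W σ _ x ∈ S) →
            (∀ x ∈ S, resH1Hom (ContinuousMonoidHom.id _) ηn hηnG x ∈ S) →
              Nat.card S =
                Nat.card {x : S // conjAct W σ _ (x : galH1Torsion (W.baseChange K) ((2 : ℤ) ^ M)) = x} ^ 2 := by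
    intro d c hj hd hcd hodd hoddc
    obtain ⟨η, hrel, hη, hpack⟩ := exists_cmGenerator_splitting W hj hd hcd hodd hoddc hΔ hΔK hc₀ hσ hτ hz
    exact ⟨-d, -c, η, hodd.neg, hoddc.neg, hrel, hη, hpack⟩
  rcases (cmInert_two_iff_of_hasCM (hcm := hCM)).1 hin with h | h | h | h | h | h
  · rcases X12.j_eq_of_cmFieldDiscrOfJ_eq_neg_three h with hj | hj | hj
    · exact main (d := -3) (c := 3) (by rw [hj]; simp [maximalCMJInvariants]) (by rw [hj]; norm_num [cmDiscr])
        (by norm_num) (by decide) (by decide)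
    · exact absurd hj h54
    · exact absurd hj hj12
  · have hj := X12.j_eq_of_cmFieldDiscrOfJ_eq_neg_eleven h
    exact main (d := -11) (c := 33) (by rw [hj]; simp [maximalCMJInvariants]) (by rw [hj]; norm_num [cmDiscr])
      (by norm_num) (by decide) (by decide)
  · have hj := X12.j_eq_of_cmFieldDiscrOfJ_eq_neg_nineteen h
    exact main (d := -19) (c := 95) (by rw [hj]; simp [maximalCMJInvariants]) (by rw [hj]; norm_num [cmDiscr])
      (by norm_num) (by decide) (by decide)
  · have hj := X12.j_eq_of_cmFieldDiscrOfJ_eq_neg_fortythree h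
    exact main (d := -43) (c := 473) (by rw [hj]; simp [maximalCMJInvariants]) (by rw [hj]; norm_num [cmDiscr])
      (by norm_num) (by decide) (by decide)
  · have hj := X12.j_eq_of_cmFieldDiscrOfJ_eq_neg_sixtyseven h
    exact main (d := -67) (c := 1139) (by rw [hj]; simp [maximalCMJInvariants]) (by rw [hj]; norm_num [cmDiscr])
      (by norm_num) (by decide) (by decide)
  · have hj := X12.j_eq_of_cmFieldDiscrOfJ_eq_neg_onesixtythree h
    exact main (d := -163) (c := 6683) (by rw [hj]; simp [maximalCMJInvariants]) (by rw [hj]; norm_num [cmDiscr])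
      (by norm_num) (by decide) (by decide)

end Summit.BirchSwinnertonDyer.BirchSwinnertonDyer.Theorems.InertOrderSplittingHabitat
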